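import Summits.ValiantsHypothesis.ValiantsHypothesis.Theorems.KPlusLogSqLawTropicalBCosetSkeleton

/-!
# Route «KPlusLogSqLaw», crux `TropicalB` (stmt-ValiantsHypothesis-19771) — coset-skeleton law, ROTATION instance:
# «one rotation register ∘ local gadgets» is at most `m · (1 + Σ_blocks (multichoose K |B| − 1))`

HONEST FRAMING.  Helper toward the registered stubs `stub_tropThin` / `stub_tropFat` of `Cruxes/TropicalB/Lines/birth.lean`
(crux `Summit.ValiantsHypothesis.ValiantsHypothesis.Theses.KPlusLogSqLaw.TropicalB`, item stmt-ValiantsHypothesis-19771, route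
KPlusLogSqLaw; cell `pub-symmetroid`, seat val-sym-trop-p4 g9, 2026-08-27; `--supports … --as helper`).  A one-step instance of
`CosetSkeleton.cosetSkeleton_law` (`…TropicalBCosetSkeleton`) with the global factor `G` = the `m` powers of the rotation `finRotate m`:
the architecture of the cell's quadratic families (SHIFT-THREE through the port embedding, DIAMOND / SQUARE / LADDER) in closed form.
A NO-GO row of the register census; nothing here bounds `TropicalB` for general designs, and nothing bears on `WeakLifting`,
DoorA26 / DoorA34, `MatrixDescartes` (stmt-ValiantsHypothesis-18050) or VP ≠ VNP.

* `rotationCoset_law` — ANY dominance design of format `(m, K)`, any column blocks `blk`; if every permutation of a dominant chain is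
  `(finRotate m)^a ∘ τ` with `τ` block-local, then `n + 1 ≤ m · (1 + Σ_j (multichoose K |B_j| − 1))`: LINEAR in `m` times an additive
  block term — quadratic in `m` for boundedly many classes per bounded block, WHATEVER the classes and valuations.  A cubic `K = 4` family
  therefore cannot live on a single rotation register with local gadgets. [this cell]
-/

set_option linter.dupNamespace false
set_option autoImplicit false

namespace Summit.ValiantsHypothesis.ValiantsHypothesis.Theorems.KPlusLogSqLaw

namespace CosetSkeleton

open Summit.ValiantsHypothesis.ValiantsHypothesis.Theorems.MatrixDescartes.Negative
open Finset

variable {m K s : ℕ}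

/-- **ROTATION ∘ LOCAL IS LINEAR × ADDITIVE.**  If every permutation of a dominant chain (strictly increasing integer slopes,
consecutive terms distinct) is a power of the rotation `finRotate m` composed with a block-local permutation, then
`n + 1 ≤ m · (1 + Σ_j (multichoose K |B_j| − 1))`. [this cell] -/
theorem rotationCoset_law (blk : Fin m → Fin s) (d : Fin K → ℕ) (v ε : Fin m → Fin m → Fin K → ℤ)
    {n : ℕ} (θ : Fin (n + 1) → ℤ) (q : Fin (n + 1) → Equiv.Perm (Fin m) × (Fin m → Fin K))
    (hθ : StrictMono θ) (hdom : ∀ k, IsDominant d v ε (θ k) (q k))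
    (hne : ∀ k : Fin n, q k.castSucc ≠ q k.succ)
    (hrot : ∀ k, ∃ a : Fin m, ∀ b, blk ((((finRotate m) ^ (a : ℕ)).symm) ((q k).1 b)) = blk b) :
    n + 1 ≤ m * (1 + ∑ j : Fin s, (Nat.multichoose K (univ.filter fun b => blk b = j).card - 1)) := by
  classical
  set G : Finset (Equiv.Perm (Fin m)) := (univ : Finset (Fin m)).image fun a : Fin m => (finRotate m) ^ (a : ℕ) with hG
  have hfac : ∀ k, ∃ g ∈ G, ∀ b, blk (g.symm ((q k).1 b)) = blk b := by
    intro k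
    obtain ⟨a, ha⟩ := hrot k
    exact ⟨(finRotate m) ^ (a : ℕ), Finset.mem_image.mpr ⟨a, mem_univ _, rfl⟩, ha⟩
  have h := cosetSkeleton_law blk G d v ε θ q hθ hdom hne hfac
  have hcard : G.card ≤ m := by
    calc G.card ≤ (univ : Finset (Fin m)).card := Finset.card_image_le
      _ = m := by rw [card_univ, Fintype.card_fin]
  exact h.trans (Nat.mul_le_mul_right _ hcard)

end CosetSkeleton

end Summit.ValiantsHypothesis.ValiantsHypothesis.Theorems.KPlusLogSqLaw
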